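import Summits.BirchSwinnertonDyer.BirchSwinnertonDyer.Theses.PAdicOrder
import Summits.BirchSwinnertonDyer.BirchSwinnertonDyer.Theses.PAdicOrderV2
import Summits.BirchSwinnertonDyer.BirchSwinnertonDyer.Theses.SelmerRank
import Summits.BirchSwinnertonDyer.BirchSwinnertonDyer.Theorems.PAdicOrderV2PadicBSDrankOrderEqCorankOdd
import Summits.BirchSwinnertonDyer.BirchSwinnertonDyer.Theorems.PAdicOrderV2PadicBSDrankRankEqCorankOfShaFinite
import Summits.BirchSwinnertonDyer.BirchSwinnertonDyer.Theorems.PAdicOrderV2PadicBSDrankLevelZeroTransfer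
import Literature.NumberTheory.EllipticCurves.PAdicBSD
import Literature.NumberTheory.EllipticCurves.SelmerCorankControl
import Literature.NumberTheory.EllipticCurves.SelmerCorankControlRatOrdinaryProofs
import Literature.NumberTheory.EllipticCurves.SelmerCorankHolds
import Literature.NumberTheory.EllipticCurves.KatoRankBound
import Literature.NumberTheory.EllipticCurves.OrdinaryPrimesProofs

/-!
# Crux #3 `PAdicOrderPadicBSDrankR2` (stmt-BirchSwinnertonDyer-0490) from the route items
# (line `Sketch`, skeleton v5.1, lead c3 — glue file, `--supports stmt-BirchSwinnertonDyer-0490`)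

Sorry-free compositions of line `Sketch` (`Cruxes/PAdicOrderPadicBSDrankR2/Lines/Sketch.lean`, v5.1),
which takes as hypotheses the three route ITEMS
`PAdicOrderMainConjectureR7` (stmt-15426: Mazur's cyclotomic main conjecture in `Λ ⊗ ℚ_p` at every
good ordinary `p ≥ 3`), `PAdicOrderSemisimpleR3` (stmt-0509: Greenberg's Conj. 1.12 at `T`, integral
spelling, `p ≠ 2`) and `SelmerRankShaPFinite` (stmt-0132: `Ш(E/ℚ)[p^∞]` finite), and uses Mazur's
control theorem as the TREE THEOREM `Greenberg1999_coinvariantsRank_eq_selmerCorank_rat_holds`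
(`SelmerCorankControlRatOrdinaryProofs`, 2026-08-17: Greenberg's Lemma 3.4 at `n = 0` is proved, so no
named Literature fact enters any more — the line's former stub CT is that theorem):

* `padicBSDrank_odd_of_items` — the crux at every ODD good ordinary prime (`ord_T L_p = corank Sel_{p^∞}`
  by the landed `stub_padicBSDrank_orderEqCorankOdd`, `= rank` by the landed
  `stub_padicBSDrank_rankEqCorankOfShaFinite`); `padicBSDrank_five_le_of_items` — its `5 ≤ p` slice,
  the only part the route's glue `CruxesToThesis` (stmt-14877) consumes (one good ordinary `p ≥ 5` per
  curve, `WeierstrassCurve.exists_good_ordinary_prime_holds`), matching crux #2's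
  `pAdicOrderComparisonR2_five_le_of_items`;
* `padicBSDrank_rankZero_of_items` — RANK ZERO AT EVERY good ordinary prime, `p = 2` INCLUDED: the
  level `ord_T L_p = 0` reads `L(E,1) ≠ 0` at every good ordinary `p` (interpolation,
  `stub_padicBSDrank_levelZeroTransfer`), and at an odd good ordinary `p'` the items give
  `ord_T L_{p'} = rank = 0`;
* `padicBSDrank_one_le_order_of_items` — in positive rank the items give `1 ≤ ord_T L_p` at every
  good ordinary `p`, `2` included (`L(E,1) = 0`, read at an odd prime and transferred);
* `padicBSDrank_atTwo_iff_of_items` — given the items, the crux at a `2`-ordinary point `(W, f)` is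
  EQUIVALENT to (`2 ≤ rank ⇒ corank Sel_{2^∞} ≤ ord_T L_2`) ∧ (`1 ≤ rank ⇒ ord_T L_2 ≤ corank Sel_{2^∞}`),
  i.e. to Kato's Thm. 18.4 at `2` from rank `2` on (printed, named fact
  `kato_selmerCorank_le_order_padicLFunction_allPrimes`) ∧ the OPEN residue NE2⁺ ("no excess zeros of
  `L_2(E,T)` in positive rank") — rank `1` needs no lower-bound input (`padicBSDrank_one_le_order_of_items`);
* `pAdicOrderPadicBSDrankR2_of_items` — the WHOLE crux from the three items, Kato's Thm. 18.4 at every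
  good ordinary prime (∀-closure of the named fact) and NE2⁺ stated verbatim as the registered stub
  `stub_padicBSDrank_noExcessTwoPos` — the glue a planner split of the crux would cite
  (`ledger route edit … --split PAdicOrderPadicBSDrankR2 --into … --glue`), plus the route-`PAdicOrder`
  spelling `…_of_items'`.

References: R. Greenberg, LNM 1716 (1999), Thm 1.2, §1 Conj. 1.12–1.13 and p. 65; K. Kato,
Astérisque 295 (2004), Thm 17.4 (2) (p. 273), Thm 18.4 (p. 281); B. Mazur, J. Tate, J. Teitelbaum,
Invent. Math. 84 (1986), §I.14 (14.3), §II.10.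
-/

-- D-0017: single-problem summit, so `Summit.BirchSwinnertonDyer.BirchSwinnertonDyer.…` repeats a
-- namespace BY DESIGN.
set_option linter.dupNamespace false

namespace Summit.BirchSwinnertonDyer.BirchSwinnertonDyer.Theorems

open scoped MatrixGroups ModularForm
open CongruenceSubgroup Literature.NumberTheory.EllipticCurves
  Literature.NumberTheory.EllipticCurves.ModularForms
open Summit.BirchSwinnertonDyer.BirchSwinnertonDyer.Theses.PAdicOrderV2
open Summit.BirchSwinnertonDyer.BirchSwinnertonDyer.Theses.SelmerRank (SelmerRankShaPFinite)

/-- **Crux #3 at every ODD good ordinary prime, from the items.** For `E/ℚ` (globally minimal `W`),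
an odd good ordinary `p` and the newform `f` of `E`: `ord_{T=0} L_p(E,T) = rank E(ℚ)`, from the route
items `PAdicOrderMainConjectureR7` (stmt-15426), `PAdicOrderSemisimpleR3` (stmt-0509),
`SelmerRankShaPFinite` (stmt-0132) and Mazur's control theorem
(`Greenberg1999_coinvariantsRank_eq_selmerCorank_rat_holds`, a tree theorem — the line's former stub CT):
`ord_T L_p = corank Sel_{p^∞}` (`stub_padicBSDrank_orderEqCorankOdd`) `= rank`
(`stub_padicBSDrank_rankEqCorankOfShaFinite`). [cite: GreenbergLNM1716, §1 Conj. 1.12–1.13 and p. 65] -/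
theorem padicBSDrank_odd_of_items (hMC : PAdicOrderMainConjectureR7) (hSS : PAdicOrderSemisimpleR3)
    (hSha : SelmerRankShaPFinite) (W : WeierstrassCurve ℚ) [W.IsElliptic] [W.IsGloballyMinimal]
    (p : ℕ) [Fact p.Prime] (hp2 : p ≠ 2) (hord : IsOrdinaryAt W p) {N : ℕ} [NeZero N]
    (f : CuspForm (Gamma0 N) 2) (hf : IsNewformOf W f) :
    (padicLFunction f (unitRoot W p : ℚ_[p])).order = W.mordellWeilRank := by
  rw [stub_padicBSDrank_orderEqCorankOdd hMC hSS Greenberg1999_coinvariantsRank_eq_selmerCorank_rat_holds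
      W p hp2 hord f hf, stub_padicBSDrank_rankEqCorankOfShaFinite W p (hSha W p)]

/-- **The `5 ≤ p` slice of crux #3 from the items** — the only part of the crux the route's glue
`CruxesToThesis` (stmt-14877) consumes. [cite: GreenbergLNM1716, §1 Conj. 1.12–1.13 and p. 65] -/
theorem padicBSDrank_five_le_of_items (hMC : PAdicOrderMainConjectureR7) (hSS : PAdicOrderSemisimpleR3)
    (hSha : SelmerRankShaPFinite) (W : WeierstrassCurve ℚ) [W.IsElliptic] [W.IsGloballyMinimal]
    (p : ℕ) [Fact p.Prime] (h5 : 5 ≤ p) (hord : IsOrdinaryAt W p) {N : ℕ} [NeZero N]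
    (f : CuspForm (Gamma0 N) 2) (hf : IsNewformOf W f) :
    (padicLFunction f (unitRoot W p : ℚ_[p])).order = W.mordellWeilRank :=
  padicBSDrank_odd_of_items hMC hSS hSha W p (by omega) hord f hf

/-- **Rank zero at EVERY good ordinary prime (`p = 2` included), from the items.** If
`rank E(ℚ) = 0` then `ord_{T=0} L_p(E,T) = 0`: at an odd good ordinary prime `p'` (one `≥ 5` exists,
`WeierstrassCurve.exists_good_ordinary_prime_holds`) the items give `ord_T L_{p'} = rank = 0`
(`padicBSDrank_odd_of_items`), and the level `ord_T L = 0` transfers between good ordinary primes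
(`stub_padicBSDrank_levelZeroTransfer`: both read `L(E,1) ≠ 0` by interpolation).
[cite: MazurTateTeitelbaum1986Invent, §I.14 (14.3)] -/
theorem padicBSDrank_rankZero_of_items (hMC : PAdicOrderMainConjectureR7) (hSS : PAdicOrderSemisimpleR3)
    (hSha : SelmerRankShaPFinite) (W : WeierstrassCurve ℚ) [W.IsElliptic]
    [W.IsGloballyMinimal] (p : ℕ) [Fact p.Prime] (hord : IsOrdinaryAt W p) {N : ℕ} [NeZero N]
    (f : CuspForm (Gamma0 N) 2) (hf : IsNewformOf W f) (h0 : W.mordellWeilRank = 0) :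
    (padicLFunction f (unitRoot W p : ℚ_[p])).order = 0 := by
  obtain ⟨q, hq, h5, hgood, hordq⟩ := WeierstrassCurve.exists_good_ordinary_prime_holds W
  have hq0 : (padicLFunction f (unitRoot W q : ℚ_[q])).order = 0 := by
    rw [padicBSDrank_odd_of_items hMC hSS hSha W q (by omega) ⟨hgood, hordq⟩ f hf, h0, Nat.cast_zero]
  exact stub_padicBSDrank_levelZeroTransfer W p hord q ⟨hgood, hordq⟩ f hf hq0

/-- **Positive rank forces `1 ≤ ord_{T=0} L_p(E,T)` at EVERY good ordinary prime (`p = 2` included),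
from the items**: if `ord_T L_p = 0` then (level transfer) `ord_T L_{p'} = 0` at an odd good ordinary
`p'`, where the items give `ord_T L_{p'} = rank ≥ 1`. [cite: MazurTateTeitelbaum1986Invent, §I.14 (14.3)] -/
theorem padicBSDrank_one_le_order_of_items (hMC : PAdicOrderMainConjectureR7) (hSS : PAdicOrderSemisimpleR3)
    (hSha : SelmerRankShaPFinite) (W : WeierstrassCurve ℚ) [W.IsElliptic]
    [W.IsGloballyMinimal] (p : ℕ) [Fact p.Prime] (hord : IsOrdinaryAt W p) {N : ℕ} [NeZero N]
    (f : CuspForm (Gamma0 N) 2) (hf : IsNewformOf W f) (hpos : 1 ≤ W.mordellWeilRank) :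
    1 ≤ (padicLFunction f (unitRoot W p : ℚ_[p])).order := by
  by_contra hlt
  have hp0 : (padicLFunction f (unitRoot W p : ℚ_[p])).order = 0 :=
    Order.lt_one_iff.mp (not_le.mp hlt)
  obtain ⟨q, hq, h5, hgood, hordq⟩ := WeierstrassCurve.exists_good_ordinary_prime_holds W
  have hq0 := stub_padicBSDrank_levelZeroTransfer W q ⟨hgood, hordq⟩ p hord f hf hp0
  rw [padicBSDrank_odd_of_items hMC hSS hSha W q (by omega) ⟨hgood, hordq⟩ f hf] at hq0
  have : W.mordellWeilRank = 0 := by exact_mod_cast hq0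
  omega

/-- **Given the items, the crux at a `2`-ordinary point is EXACTLY a two-clause sandwich.** For
`E/ℚ` (globally minimal `W`) good ordinary at `p = 2` and the newform `f` of `E`:
`ord_T L_2(E,T) = rank E(ℚ)` **iff**
(`2 ≤ rank ⇒ corank Sel_{2^∞} ≤ ord_T L_2`) ∧ (`1 ≤ rank ⇒ ord_T L_2 ≤ corank Sel_{2^∞}`).
The first clause is Kato's Thm. 18.4 at `2` (printed, parity-free: Astérisque 295, pp. 273, 281; named
fact `kato_selmerCorank_le_order_padicLFunction_allPrimes`) and is needed only from rank `2` on — in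
rank `1` the items already give `1 ≤ ord_T L_2` (`padicBSDrank_one_le_order_of_items`); the second
clause is the OPEN residue NE2⁺ of line `Sketch` ("no excess zeros of `L_2(E,T)` in positive rank");
rank `0` is `padicBSDrank_rankZero_of_items`, and `corank Sel_{2^∞} = rank` is item 0132
(`stub_padicBSDrank_rankEqCorankOfShaFinite`).
[cite: Kato2004Asterisque, Thm. 18.4 (p. 281)] [cite: MazurTateTeitelbaum1986Invent, §II.10] -/
theorem padicBSDrank_atTwo_iff_of_items (hMC : PAdicOrderMainConjectureR7) (hSS : PAdicOrderSemisimpleR3)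
    (hSha : SelmerRankShaPFinite) (W : WeierstrassCurve ℚ) [W.IsElliptic]
    [W.IsGloballyMinimal] (p : ℕ) [Fact p.Prime] (hp2 : p = 2) (hord : IsOrdinaryAt W p) {N : ℕ}
    [NeZero N] (f : CuspForm (Gamma0 N) 2) (hf : IsNewformOf W f) :
    (padicLFunction f (unitRoot W p : ℚ_[p])).order = W.mordellWeilRank ↔
      ((2 ≤ W.mordellWeilRank →
          (W.selmerCorank p : ℕ∞) ≤ (padicLFunction f (unitRoot W p : ℚ_[p])).order) ∧
        (1 ≤ W.mordellWeilRank →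
          (padicLFunction f (unitRoot W p : ℚ_[p])).order ≤ W.selmerCorank p)) := by
  subst hp2
  have hshaEq : W.selmerCorank 2 = W.mordellWeilRank :=
    stub_padicBSDrank_rankEqCorankOfShaFinite W 2 (hSha W 2)
  rw [hshaEq]
  constructor
  · intro h
    exact ⟨fun _ ↦ h.ge, fun _ ↦ h.le⟩
  · rintro ⟨hlow, hup⟩
    rcases Nat.eq_zero_or_pos W.mordellWeilRank with h0 | hpos
    · rw [padicBSDrank_rankZero_of_items hMC hSS hSha W 2 hord f hf h0, h0, Nat.cast_zero]
    · refine le_antisymm (hup hpos) ?_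
      rcases Nat.lt_or_ge W.mordellWeilRank 2 with h1 | h2
      · have hr1 : W.mordellWeilRank = 1 := by omega
        rw [hr1, Nat.cast_one]
        exact padicBSDrank_one_le_order_of_items hMC hSS hSha W 2 hord f hf hpos
      · exact hlow h2

/-- **The whole crux #3 `PAdicOrderPadicBSDrankR2` from the three route items, Kato's Thm. 18.4 at
every good ordinary prime (the ∀-closure `hK` of the named fact
`kato_selmerCorank_le_order_padicLFunction_allPrimes`, consumed only at `p = 2` in positive rank) and
the OPEN residue NE2⁺ (`hNE2`, verbatim the registered stub `stub_padicBSDrank_noExcessTwoPos` of line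
`Sketch`: at `p = 2` in positive rank, `ord_T L_2 ≤ corank Sel_{2^∞}`).** This is the sorry-free form
of the line's composition `pAdicOrderPadicBSDrankR2_of` (skeleton v5.1): odd `p` by
`padicBSDrank_odd_of_items`; `p = 2`, rank `0` by `padicBSDrank_rankZero_of_items`; `p = 2`, positive
rank by `hK`, `hNE2` and item 0132. The glue a planner split of the crux into
{stmt-15426, stmt-0509, stmt-0132, Kato 18.4, NE2⁺} would cite.
[cite: GreenbergLNM1716, §1 Conj. 1.12–1.13 and p. 65] [cite: Kato2004Asterisque, Thm. 18.4 (p. 281)] -/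
theorem pAdicOrderPadicBSDrankR2_of_items (hMC : PAdicOrderMainConjectureR7) (hSS : PAdicOrderSemisimpleR3)
    (hSha : SelmerRankShaPFinite)
    (hK : ∀ (W : WeierstrassCurve ℚ) [W.IsElliptic] [W.IsGloballyMinimal] (p : ℕ) [Fact p.Prime]
      {N : ℕ} [NeZero N] (f : CuspForm (Gamma0 N) 2),
      kato_selmerCorank_le_order_padicLFunction_allPrimes W p (f := f))
    (hNE2 : ∀ (W : WeierstrassCurve ℚ) [W.IsElliptic] [W.IsGloballyMinimal] (p : ℕ) [Fact p.Prime],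
      p = 2 → IsOrdinaryAt W p → ∀ {N : ℕ} [NeZero N] (f : CuspForm (Gamma0 N) 2), IsNewformOf W f →
      1 ≤ W.mordellWeilRank →
      (padicLFunction f (unitRoot W p : ℚ_[p])).order ≤ W.selmerCorank p) :
    PAdicOrderPadicBSDrankR2 := by
  intro W _ _ p _ hord N _ f hf
  by_cases hp2 : p = 2
  · exact (padicBSDrank_atTwo_iff_of_items hMC hSS hSha W p hp2 hord f hf).mpr
      ⟨fun _ ↦ hK W p f hord hf, hNE2 W p hp2 hord f hf⟩
  · exact padicBSDrank_odd_of_items hMC hSS hSha W p hp2 hord f hf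


/-- **The whole crux #3, route-`PAdicOrder` spelling** (`Theses.PAdicOrder.PAdicOrderPadicBSDrankR2`
and `Theses.PAdicOrder.PAdicOrderSemisimpleR3` have bodies byte-identical to their `PAdicOrderV2`
twins, `Iff.rfl`), from the same items and hypotheses as `pAdicOrderPadicBSDrankR2_of_items`.
[cite: GreenbergLNM1716, §1 Conj. 1.12–1.13 and p. 65] -/
theorem pAdicOrderPadicBSDrankR2_of_items' (hMC : PAdicOrderMainConjectureR7)
    (hSS : Theses.PAdicOrder.PAdicOrderSemisimpleR3) (hSha : SelmerRankShaPFinite)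
    (hK : ∀ (W : WeierstrassCurve ℚ) [W.IsElliptic] [W.IsGloballyMinimal] (p : ℕ) [Fact p.Prime]
      {N : ℕ} [NeZero N] (f : CuspForm (Gamma0 N) 2),
      kato_selmerCorank_le_order_padicLFunction_allPrimes W p (f := f))
    (hNE2 : ∀ (W : WeierstrassCurve ℚ) [W.IsElliptic] [W.IsGloballyMinimal] (p : ℕ) [Fact p.Prime],
      p = 2 → IsOrdinaryAt W p → ∀ {N : ℕ} [NeZero N] (f : CuspForm (Gamma0 N) 2), IsNewformOf W f →
      1 ≤ W.mordellWeilRank →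
      (padicLFunction f (unitRoot W p : ℚ_[p])).order ≤ W.selmerCorank p) :
    Theses.PAdicOrder.PAdicOrderPadicBSDrankR2 :=
  (Iff.rfl : Theses.PAdicOrder.PAdicOrderPadicBSDrankR2 ↔ PAdicOrderPadicBSDrankR2).mpr
    (pAdicOrderPadicBSDrankR2_of_items hMC
      ((Iff.rfl : Theses.PAdicOrder.PAdicOrderSemisimpleR3 ↔ PAdicOrderSemisimpleR3).mp hSS)
      hSha hK hNE2)

end Summit.BirchSwinnertonDyer.BirchSwinnertonDyer.Theorems
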